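import Summits.QuantumFields.YangMills.Theorems.DressedRitz.Negative.DressedMixtureHazard
import Literature.NumberTheory.LFunctions.PrimeReciprocalWindows
import HarnessLib

/-!
# Route `LuscherReduction`, crux `DressedRitz` (stmt-QuantumFields-20205), line «polyakovlift» r5 — NEGATIVE lane:
# the quasimode currency of S-PSCAL is a SECOND-MOMENT strengthening of budget (i) — the two-level exchange rate

Negative-side support lemmas of the standing disprover (seat `ym-cdisprove-20205-1`, GEN 6; work file `Cruxes/DressedRitz/Disproof.lean` §10).
Nothing here asserts a route item; nothing here refutes one.  Context: lane W1-A reduced the stub `stub_pscaling` (`∀ k, PScalingExistsAt k`) to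
ONE inequality per shadow vector — `ShadowQuasimodeAt k → DressedShadowQuasimodeAt k → ShadowBudgetAt k → PScalingExistsAt k`
(`…PolyakovLiftShadowQuasimode[Undressed].lean`, press-button `budgetI_of_quasimode`): the shadow `w` is a QUASIMODE of `K_B`,
`|a − μ_{i+1}| ≤ Ctμ₀` and `‖(K_B − a)w‖² ≤ (Ctμ₀)²‖w‖²` (`t = Λ²/L`), and then budget (i) of `ShadowBudgetAt` holds with tolerance
`1 − e^{−16Ct}`.  This file records, kernel-checked and in closed form, that the converse direction FAILS and at which exchange rate, on the
smallest model: an `l2`-orthonormal physical exact eigenpair `ψ₁, ψ₂` of `K_β` (levels `κ₁ > κ₂`) and the admixture `w = ψ₁ + s•ψ₂`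
(far weight `δ = s²/(1+s²)`).

* §1 CLOSED FORMS.  `⟨w,ψ₁⟩ = 1`, `⟨w,ψ₂⟩ = s`, `‖w‖² = 1 + s²`; the residual `(K_β − a)w = (κ₁−a)ψ₁ + s(κ₂−a)ψ₂`
  (`residual_admixture_eq`), `‖(K_β − a)w‖² = (κ₁−a)² + s²(κ₂−a)²` (`l2_residual_admixture`); the budget-(i) number of `w` against the exact
  family `![ψ₁, ψ₂]`, levels `![κ₁, κ₂]`, pivot `κ₁`: `Σ_j|κ_j − κ₁|⟨w,ψ_j⟩² + λ₀‖w − Σ_j⟨w,ψ_j⟩ψ_j‖² = |κ₂ − κ₁|·s²` (`firstMoment_admixture`;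
  the remainder vanishes identically).
* §2 THE QUASIMODE SIDE (second moment).  If `|a − κ₁| ≤ ρ ≤ κ₁ − κ₂` and `‖(K_β − a)w‖² ≤ ρ²‖w‖²` then `s²(κ₁−κ₂−ρ)² ≤ ρ²(1+s²)`
  (`admixture_sq_le_of_quasimode`): the admixture weight is charged the SQUARE of gap-over-tolerance, `δ ≤ ρ²/(κ₁−κ₂−ρ)²`; conversely
  `ρ²(1+s²) < s²(κ₁−κ₂−ρ)²` excludes every admissible `a` (`not_quasimode_of_admixture`).
* §3 THE BUDGET SIDE (first moment).  `(κ₁−κ₂)s² ≤ ½τ·κ₁(1+s²)`, `0 ≤ τ ≤ 1` ⟹ budget (i) with tolerance `1 − e^{−τ}` (`budgetI_of_admixture`):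
  the admixture weight is charged gap-over-tolerance ONCE, `δ·(κ₁−κ₂) ≤ ½τκ₁`.
* §4 ★★ SEPARATION IN THE LANE'S CALIBRATION (`quasimode_budget_separation`).  With `λ₀/2 ≤ κ₁ ≤ λ₀`, `0 ≤ κ₂ ≤ κ₁/2` (a hard admixture),
  `0 < Ct ≤ 1/32` and `s² = 8Ct`: the FULL `∃ N ψ ev κ`-package of budget (i) holds for `w` at tolerance `1 − e^{−16Ct}` (w1a's constant
  `C₂ = 16C`, pivot `κ = κ₁`, `C₁ = 0`), while the quasimode inequality `‖(K_β − a)w‖² ≤ (Ctλ₀)²‖w‖²` fails for EVERY `a` with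
  `|a − κ₁| ≤ Ctλ₀`.  So `DressedShadowQuasimodeAt` is strictly stronger, per vector, than clause (i) of `ShadowBudgetAt`: far weight `δ ≍ t`
  passes the budget and fails the quasimode, which needs `δ ≲ t²` against an `O(1)` relative gap (and `δ ≲ (CΛ/Δε)²` against a tower gap
  `Δε·(Λ/L)·λ₀`).

READING (cdisprove g6, (G6-b) in `Disproof.lean` §10): located currency, not a defect of the lane — for the transplanted one-site shadow the far
admixture AMPLITUDE is itself first-order small, so its weight is second-order small and the quasimode form is the natural output of one-site
perturbation theory in two couplings (Kato); the lemmas below only fix the exchange rate a prover of `ShadowQuasimodeAt k` must meet and show that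
budget-(i)-level information can never be upgraded to it.  HONEST FRAMING: fixed-lattice linear algebra about hypotheses of a stub of a child of the
CONDITIONAL reduction route R2b1; no stub is closed or refuted; nothing here bears on infinite volume, the continuum limit or the Clay mass gap.
References: T. Kato, J. Phys. Soc. Japan 4 (1949) 334 [cite: Kato1949, §1]; M. Lüscher, NPB 219 (1983) 233 [cite: Luscher1983, §3].
-/

set_option autoImplicit false

noncomputable section

open MeasureTheory Filter Topology Real
open Literature.MathematicalPhysics.QuantumFieldTheory (GaugeConfig Site gaugeTransform)
open scoped BigOperators

namespace Summit.QuantumFields.YangMills.Theorems.FemtoTransferGap.PolyakovLift.Negative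

open Summit.QuantumFields.YangMills.Theorems.FemtoTransferGap
open Summit.QuantumFields.YangMills.Theorems.FemtoTransferGap.PolyakovLift

section TwoLevel

variable {L : ℕ} [NeZero L] (β : ℝ) {ψ₁ ψ₂ : GaugeConfig 3 L SU2 → ℝ} {κ₁ κ₂ : ℝ}

/-! ## §1 Closed forms for the admixture `w = ψ₁ + s•ψ₂` -/

/-- `⟨ψ₁ + sψ₂, ψ₁⟩ = 1`. [folklore] -/
theorem l2_admixture_fst (h₁ : IsPhys ψ₁) (h₂ : IsPhys ψ₂) (hn₁ : l2 ψ₁ ψ₁ = 1) (hn₂ : l2 ψ₂ ψ₂ = 1) (h₁₂ : l2 ψ₁ ψ₂ = 0)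
    (s : ℝ) : l2 (ψ₁ + s • ψ₂) ψ₁ = 1 := by
  have hw : ψ₁ + s • ψ₂ = (1 : ℝ) • ψ₁ + s • ψ₂ := by rw [one_smul]
  have hv : ψ₁ = (1 : ℝ) • ψ₁ + (0 : ℝ) • ψ₂ := by rw [one_smul, zero_smul, add_zero]
  rw [hw]
  conv_lhs => arg 2; rw [hv]
  rw [l2_twoLevel_pair h₁ h₂ hn₁ hn₂ h₁₂]
  ring

/-- `⟨ψ₁ + sψ₂, ψ₂⟩ = s`. [folklore] -/
theorem l2_admixture_snd (h₁ : IsPhys ψ₁) (h₂ : IsPhys ψ₂) (hn₁ : l2 ψ₁ ψ₁ = 1) (hn₂ : l2 ψ₂ ψ₂ = 1) (h₁₂ : l2 ψ₁ ψ₂ = 0)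
    (s : ℝ) : l2 (ψ₁ + s • ψ₂) ψ₂ = s := by
  have hw : ψ₁ + s • ψ₂ = (1 : ℝ) • ψ₁ + s • ψ₂ := by rw [one_smul]
  have hv : ψ₂ = (0 : ℝ) • ψ₁ + (1 : ℝ) • ψ₂ := by rw [one_smul, zero_smul, zero_add]
  rw [hw]
  conv_lhs => arg 2; rw [hv]
  rw [l2_twoLevel_pair h₁ h₂ hn₁ hn₂ h₁₂]
  ring

/-- `‖ψ₁ + sψ₂‖² = 1 + s²`. [folklore] -/
theorem l2_admixture_self (h₁ : IsPhys ψ₁) (h₂ : IsPhys ψ₂) (hn₁ : l2 ψ₁ ψ₁ = 1) (hn₂ : l2 ψ₂ ψ₂ = 1) (h₁₂ : l2 ψ₁ ψ₂ = 0)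
    (s : ℝ) : l2 (ψ₁ + s • ψ₂) (ψ₁ + s • ψ₂) = 1 + s ^ 2 := by
  have hw : ψ₁ + s • ψ₂ = (1 : ℝ) • ψ₁ + s • ψ₂ := by rw [one_smul]
  rw [hw, l2_twoLevel_pair h₁ h₂ hn₁ hn₂ h₁₂]
  ring

/-- The residual of the admixture at an approximate eigenvalue `a`: `(K_β − a)(ψ₁ + sψ₂) = (κ₁ − a)ψ₁ + s(κ₂ − a)ψ₂`. [folklore] -/
theorem residual_admixture_eq (h₁ : IsPhys ψ₁) (h₂ : IsPhys ψ₂)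
    (he₁ : transferApply β ψ₁ = κ₁ • ψ₁) (he₂ : transferApply β ψ₂ = κ₂ • ψ₂) (s a : ℝ) :
    transferApply β (ψ₁ + s • ψ₂) - a • (ψ₁ + s • ψ₂) = (κ₁ - a) • ψ₁ + (s * (κ₂ - a)) • ψ₂ := by
  have hw : ψ₁ + s • ψ₂ = (1 : ℝ) • ψ₁ + s • ψ₂ := by rw [one_smul]
  rw [hw, transferApply_twoLevel β h₁ h₂ he₁ he₂]
  module

/-- ★ **Squared residual of the admixture**: `‖(K_β − a)(ψ₁ + sψ₂)‖² = (κ₁ − a)² + s²(κ₂ − a)²`. [cite: Kato1949, §1] -/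
theorem l2_residual_admixture (h₁ : IsPhys ψ₁) (h₂ : IsPhys ψ₂)
    (he₁ : transferApply β ψ₁ = κ₁ • ψ₁) (he₂ : transferApply β ψ₂ = κ₂ • ψ₂)
    (hn₁ : l2 ψ₁ ψ₁ = 1) (hn₂ : l2 ψ₂ ψ₂ = 1) (h₁₂ : l2 ψ₁ ψ₂ = 0) (s a : ℝ) :
    l2 (transferApply β (ψ₁ + s • ψ₂) - a • (ψ₁ + s • ψ₂)) (transferApply β (ψ₁ + s • ψ₂) - a • (ψ₁ + s • ψ₂)) =
      (κ₁ - a) ^ 2 + s ^ 2 * (κ₂ - a) ^ 2 := by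
  rw [residual_admixture_eq β h₁ h₂ he₁ he₂, l2_twoLevel_pair h₁ h₂ hn₁ hn₂ h₁₂]
  ring

omit [NeZero L] in
/-- The two-level family `![ψ₁, ψ₂]` is physical. [folklore] -/
theorem twoLevel_isPhys (h₁ : IsPhys ψ₁) (h₂ : IsPhys ψ₂) : ∀ j : Fin 2, IsPhys (![ψ₁, ψ₂] j) := by
  rw [Fin.forall_fin_two]
  exact ⟨h₁, h₂⟩

/-- The two-level family `![ψ₁, ψ₂]` is `l2`-orthonormal. [folklore] -/
theorem twoLevel_orthonormal (h₁ : IsPhys ψ₁) (h₂ : IsPhys ψ₂) (hn₁ : l2 ψ₁ ψ₁ = 1) (hn₂ : l2 ψ₂ ψ₂ = 1) (h₁₂ : l2 ψ₁ ψ₂ = 0) :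
    ∀ j l : Fin 2, l2 (![ψ₁, ψ₂] j) (![ψ₁, ψ₂] l) = if j = l then 1 else 0 := by
  have _h₁ := h₁
  have _h₂ := h₂
  have h₂₁ : l2 ψ₂ ψ₁ = 0 := by rw [l2_comm]; exact h₁₂
  rw [Fin.forall_fin_two]
  refine ⟨?_, ?_⟩ <;> rw [Fin.forall_fin_two] <;> simp [hn₁, hn₂, h₁₂, h₂₁]

/-- The two-level family `![ψ₁, ψ₂]` is an exact eigenfamily with levels `![κ₁, κ₂]`. [folklore] -/
theorem twoLevel_eigen (he₁ : transferApply β ψ₁ = κ₁ • ψ₁) (he₂ : transferApply β ψ₂ = κ₂ • ψ₂) :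
    ∀ j : Fin 2, transferApply β (![ψ₁, ψ₂] j) = ![κ₁, κ₂] j • ![ψ₁, ψ₂] j := by
  rw [Fin.forall_fin_two]
  exact ⟨by simpa using he₁, by simpa using he₂⟩

/-- ★ **The budget-(i) number of the admixture in closed form**: against the exact family `![ψ₁, ψ₂]` (levels `![κ₁, κ₂]`, pivot `κ₁`), for ANY
remainder weight `m0`, `Σ_j |κ_j − κ₁|·⟨w,ψ_j⟩² + m0·‖w − Σ_j⟨w,ψ_j⟩ψ_j‖² = |κ₂ − κ₁|·s²` (the remainder is identically zero). [cite: Kato1949, §1] -/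
theorem firstMoment_admixture (h₁ : IsPhys ψ₁) (h₂ : IsPhys ψ₂) (hn₁ : l2 ψ₁ ψ₁ = 1) (hn₂ : l2 ψ₂ ψ₂ = 1) (h₁₂ : l2 ψ₁ ψ₂ = 0)
    (s m0 : ℝ) :
    ∑ j, |![κ₁, κ₂] j - κ₁| * l2 (ψ₁ + s • ψ₂) (![ψ₁, ψ₂] j) ^ 2 +
        m0 * l2 (ψ₁ + s • ψ₂ - ∑ j, l2 (ψ₁ + s • ψ₂) (![ψ₁, ψ₂] j) • ![ψ₁, ψ₂] j)
          (ψ₁ + s • ψ₂ - ∑ j, l2 (ψ₁ + s • ψ₂) (![ψ₁, ψ₂] j) • ![ψ₁, ψ₂] j) =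
      |κ₂ - κ₁| * s ^ 2 := by
  simp only [Fin.sum_univ_two, Matrix.cons_val_zero, Matrix.cons_val_one,
    l2_admixture_fst h₁ h₂ hn₁ hn₂ h₁₂, l2_admixture_snd h₁ h₂ hn₁ hn₂ h₁₂]
  have hrem : ψ₁ + s • ψ₂ - ((1 : ℝ) • ψ₁ + s • ψ₂) = (0 : ℝ) • ψ₁ + (0 : ℝ) • ψ₂ := by module
  rw [hrem, l2_twoLevel_pair h₁ h₂ hn₁ hn₂ h₁₂]
  simp

/-! ## §2 The quasimode side: the admixture weight is charged the SQUARE of gap-over-tolerance -/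

/-- ★ **What a quasimode bound buys on the admixture.**  If `|a − κ₁| ≤ ρ ≤ κ₁ − κ₂` and `‖(K_β − a)w‖² ≤ ρ²‖w‖²` for `w = ψ₁ + sψ₂`, then
`s²(κ₁ − κ₂ − ρ)² ≤ ρ²(1 + s²)`, i.e. the far weight `δ = s²/(1+s²)` satisfies `δ ≤ ρ²/(κ₁−κ₂−ρ)²`. [cite: Kato1949, §1] -/
theorem admixture_sq_le_of_quasimode (h₁ : IsPhys ψ₁) (h₂ : IsPhys ψ₂)
    (he₁ : transferApply β ψ₁ = κ₁ • ψ₁) (he₂ : transferApply β ψ₂ = κ₂ • ψ₂)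
    (hn₁ : l2 ψ₁ ψ₁ = 1) (hn₂ : l2 ψ₂ ψ₂ = 1) (h₁₂ : l2 ψ₁ ψ₂ = 0) (s : ℝ) {ρ a : ℝ} (hρ : ρ ≤ κ₁ - κ₂) (ha : |a - κ₁| ≤ ρ)
    (hq : l2 (transferApply β (ψ₁ + s • ψ₂) - a • (ψ₁ + s • ψ₂)) (transferApply β (ψ₁ + s • ψ₂) - a • (ψ₁ + s • ψ₂)) ≤
      ρ ^ 2 * l2 (ψ₁ + s • ψ₂) (ψ₁ + s • ψ₂)) :
    s ^ 2 * (κ₁ - κ₂ - ρ) ^ 2 ≤ ρ ^ 2 * (1 + s ^ 2) := by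
  rw [l2_residual_admixture β h₁ h₂ he₁ he₂ hn₁ hn₂ h₁₂, l2_admixture_self h₁ h₂ hn₁ hn₂ h₁₂] at hq
  have hlo : κ₁ - ρ ≤ a := by have := (abs_le.mp ha).1; linarith
  have hge0 : 0 ≤ κ₁ - κ₂ - ρ := by linarith
  have hmono : (κ₁ - κ₂ - ρ) ^ 2 ≤ (κ₂ - a) ^ 2 := by
    have h := pow_le_pow_left₀ hge0 (show κ₁ - κ₂ - ρ ≤ a - κ₂ by linarith) 2
    calc (κ₁ - κ₂ - ρ) ^ 2 ≤ (a - κ₂) ^ 2 := h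
      _ = (κ₂ - a) ^ 2 := by ring
  nlinarith [mul_le_mul_of_nonneg_left hmono (sq_nonneg s), sq_nonneg (κ₁ - a)]

/-- ★ **No admissible approximate eigenvalue.**  If `ρ ≤ κ₁ − κ₂` and `ρ²(1 + s²) < s²(κ₁ − κ₂ − ρ)²` then NO `a` with `|a − κ₁| ≤ ρ` makes
`w = ψ₁ + sψ₂` a `ρ`-quasimode: `¬ ∃ a, |a − κ₁| ≤ ρ ∧ ‖(K_β − a)w‖² ≤ ρ²‖w‖²`. [cite: Kato1949, §1] -/
theorem not_quasimode_of_admixture (h₁ : IsPhys ψ₁) (h₂ : IsPhys ψ₂)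
    (he₁ : transferApply β ψ₁ = κ₁ • ψ₁) (he₂ : transferApply β ψ₂ = κ₂ • ψ₂)
    (hn₁ : l2 ψ₁ ψ₁ = 1) (hn₂ : l2 ψ₂ ψ₂ = 1) (h₁₂ : l2 ψ₁ ψ₂ = 0) (s : ℝ) {ρ : ℝ} (hρ : ρ ≤ κ₁ - κ₂)
    (hsep : ρ ^ 2 * (1 + s ^ 2) < s ^ 2 * (κ₁ - κ₂ - ρ) ^ 2) :
    ¬ ∃ a : ℝ, |a - κ₁| ≤ ρ ∧
      l2 (transferApply β (ψ₁ + s • ψ₂) - a • (ψ₁ + s • ψ₂)) (transferApply β (ψ₁ + s • ψ₂) - a • (ψ₁ + s • ψ₂)) ≤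
        ρ ^ 2 * l2 (ψ₁ + s • ψ₂) (ψ₁ + s • ψ₂) := by
  rintro ⟨a, ha, hq⟩
  exact absurd (admixture_sq_le_of_quasimode β h₁ h₂ he₁ he₂ hn₁ hn₂ h₁₂ s hρ ha hq) (not_le.mpr hsep)

/-! ## §3 The budget side: the admixture weight is charged gap-over-tolerance ONCE -/

/-- ★ **Budget (i) for the admixture from a first-moment bound.**  If `κ₂ ≤ κ₁`, `0 ≤ τ ≤ 1` and `(κ₁ − κ₂)s² ≤ ½τ·κ₁(1 + s²)` then the
budget-(i) number of `w = ψ₁ + sψ₂` (family `![ψ₁, ψ₂]`, levels `![κ₁, κ₂]`, pivot `κ₁`, any remainder weight `m0`) is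
`≤ (1 − e^{−τ})·κ₁‖w‖²` (`½τ ≤ 1 − e^{−τ}` on `[0,1]`). [cite: Kato1949, §1] -/
theorem budgetI_of_admixture (h₁ : IsPhys ψ₁) (h₂ : IsPhys ψ₂) (hn₁ : l2 ψ₁ ψ₁ = 1) (hn₂ : l2 ψ₂ ψ₂ = 1) (h₁₂ : l2 ψ₁ ψ₂ = 0)
    (s m0 : ℝ) (hκ : κ₂ ≤ κ₁) (hκ₁ : 0 ≤ κ₁) {τ : ℝ} (hτ0 : 0 ≤ τ) (hτ1 : τ ≤ 1)
    (hsmall : (κ₁ - κ₂) * s ^ 2 ≤ τ / 2 * (κ₁ * (1 + s ^ 2))) :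
    ∑ j, |![κ₁, κ₂] j - κ₁| * l2 (ψ₁ + s • ψ₂) (![ψ₁, ψ₂] j) ^ 2 +
        m0 * l2 (ψ₁ + s • ψ₂ - ∑ j, l2 (ψ₁ + s • ψ₂) (![ψ₁, ψ₂] j) • ![ψ₁, ψ₂] j)
          (ψ₁ + s • ψ₂ - ∑ j, l2 (ψ₁ + s • ψ₂) (![ψ₁, ψ₂] j) • ![ψ₁, ψ₂] j) ≤
      (1 - Real.exp (-τ)) * (κ₁ * l2 (ψ₁ + s • ψ₂) (ψ₁ + s • ψ₂)) := by
  rw [firstMoment_admixture h₁ h₂ hn₁ hn₂ h₁₂, l2_admixture_self h₁ h₂ hn₁ hn₂ h₁₂,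
    show |κ₂ - κ₁| = κ₁ - κ₂ by rw [abs_sub_comm]; exact abs_of_nonneg (by linarith)]
  have hexp := Literature.NumberTheory.LFunctions.PrimeReciprocal.half_le_one_sub_exp_neg hτ0 hτ1
  have hpos : 0 ≤ κ₁ * (1 + s ^ 2) := by positivity
  calc (κ₁ - κ₂) * s ^ 2 ≤ τ / 2 * (κ₁ * (1 + s ^ 2)) := hsmall
    _ ≤ (1 - Real.exp (-τ)) * (κ₁ * (1 + s ^ 2)) := mul_le_mul_of_nonneg_right hexp hpos

/-! ## §4 Separation in the lane's calibration: budget (i) holds, the quasimode inequality fails for every admissible `a` -/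

/-- ★★ **Quasimode ⊋ budget (i), in w1a's calibration.**  `ψ₁, ψ₂` an `l2`-orthonormal physical exact eigenpair of `K_β` with
`0 < λ₀`, `λ₀/2 ≤ κ₁ ≤ λ₀` and `0 ≤ κ₂ ≤ κ₁/2` (a HARD admixture: relative gap `≥ ½`), `0 ≤ C`, `0 ≤ t`, `0 < Ct ≤ 1/32` (`t = Λ²/L` in S-PSCAL), far
weight `s² = 8Ct`.  Then for `w = ψ₁ + sψ₂`:
(a) the full `∃ N ψ ev κ`-package of clause (i) of `ShadowBudgetAt` holds — family `![ψ₁,ψ₂]`, levels `![κ₁,κ₂]`, pivot `κ = κ₁`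
(`0 ≤ κ ≤ λ₀`), tolerance `1 − e^{−16Ct}` (w1a's `C₂ = 16C`; `C₁ = 0` when `κ₁` is the target level) — and
(b) `‖(K_β − a)w‖² ≤ (Ctλ₀)²‖w‖²` FAILS for every `a` with `|a − κ₁| ≤ Ctλ₀` (the per-vector clause of `DressedShadowQuasimodeAt`).
Numerically: budget number `(κ₁−κ₂)·8Ct ≤ 8Ct·κ₁(1+s²)`; residual `≥ 8Ct·(7λ₀/32)² ≈ 0.38·Ct·λ₀²` against the allowance
`(Ctλ₀)²(1+8Ct) ≤ 0.04·Ct·λ₀²`. [cite: Kato1949, §1] -/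
theorem quasimode_budget_separation (h₁ : IsPhys ψ₁) (h₂ : IsPhys ψ₂)
    (he₁ : transferApply β ψ₁ = κ₁ • ψ₁) (he₂ : transferApply β ψ₂ = κ₂ • ψ₂)
    (hn₁ : l2 ψ₁ ψ₁ = 1) (hn₂ : l2 ψ₂ ψ₂ = 1) (h₁₂ : l2 ψ₁ ψ₂ = 0)
    (hm0 : 0 < levelValue su2Rep L β 0) (hκ₁lo : levelValue su2Rep L β 0 / 2 ≤ κ₁) (hκ₁hi : κ₁ ≤ levelValue su2Rep L β 0)
    (hκ₂lo : 0 ≤ κ₂) (hκ₂hi : κ₂ ≤ κ₁ / 2) {C t s : ℝ} (hC : 0 ≤ C) (ht : 0 ≤ t) (hCt0 : 0 < C * t) (hCt : C * t ≤ 1 / 32)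
    (hs : s ^ 2 = 8 * (C * t)) :
    (∃ (N : ℕ) (ψ : Fin N → (GaugeConfig 3 L SU2 → ℝ)) (ev : Fin N → ℝ) (κ : ℝ),
        (∀ j, IsPhys (ψ j)) ∧ (∀ j l, l2 (ψ j) (ψ l) = if j = l then 1 else 0) ∧
        (∀ j, transferApply β (ψ j) = ev j • ψ j) ∧ 0 ≤ κ ∧ κ ≤ levelValue su2Rep L β 0 ∧ κ = κ₁ ∧
        ∑ j, |ev j - κ| * l2 (ψ₁ + s • ψ₂) (ψ j) ^ 2 +
            levelValue su2Rep L β 0 *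
              l2 (ψ₁ + s • ψ₂ - ∑ j, l2 (ψ₁ + s • ψ₂) (ψ j) • ψ j) (ψ₁ + s • ψ₂ - ∑ j, l2 (ψ₁ + s • ψ₂) (ψ j) • ψ j) ≤
          (1 - Real.exp (-(16 * C * t))) * (κ * l2 (ψ₁ + s • ψ₂) (ψ₁ + s • ψ₂))) ∧
      ∀ a : ℝ, |a - κ₁| ≤ C * t * levelValue su2Rep L β 0 →
        ¬ l2 (transferApply β (ψ₁ + s • ψ₂) - a • (ψ₁ + s • ψ₂)) (transferApply β (ψ₁ + s • ψ₂) - a • (ψ₁ + s • ψ₂)) ≤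
            (C * t * levelValue su2Rep L β 0) ^ 2 * l2 (ψ₁ + s • ψ₂) (ψ₁ + s • ψ₂) := by
  set m0 := levelValue su2Rep L β 0 with hm0def
  have hκ₁0 : 0 ≤ κ₁ := by linarith
  refine ⟨⟨2, ![ψ₁, ψ₂], ![κ₁, κ₂], κ₁, twoLevel_isPhys h₁ h₂, twoLevel_orthonormal h₁ h₂ hn₁ hn₂ h₁₂, twoLevel_eigen β he₁ he₂,
    hκ₁0, hκ₁hi, rfl, ?_⟩, ?_⟩
  · -- (a) budget (i): `τ = 16Ct ∈ [0, 1]`, `(κ₁ − κ₂)s² ≤ κ₁·8Ct ≤ 8Ct·κ₁(1+s²)`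
    have hτ0 : 0 ≤ 16 * C * t := by positivity
    have hτ1 : 16 * C * t ≤ 1 := by nlinarith
    refine budgetI_of_admixture h₁ h₂ hn₁ hn₂ h₁₂ s m0 (by linarith) hκ₁0 hτ0 hτ1 ?_
    have hs0 : 0 ≤ s ^ 2 := sq_nonneg s
    calc (κ₁ - κ₂) * s ^ 2 ≤ κ₁ * s ^ 2 := by nlinarith
      _ = 16 * C * t / 2 * (κ₁ * 1) := by rw [hs]; ring
      _ ≤ 16 * C * t / 2 * (κ₁ * (1 + s ^ 2)) := by
          apply mul_le_mul_of_nonneg_left _ (by positivity)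
          exact mul_le_mul_of_nonneg_left (by linarith) hκ₁0
  · -- (b) the quasimode inequality fails: `ρ = Ctλ₀ ≤ λ₀/32`, gap `κ₁ − κ₂ − ρ ≥ 7λ₀/32`
    intro a ha hq
    have hρ : C * t * m0 ≤ m0 / 32 := by nlinarith
    have hρ0 : 0 ≤ C * t * m0 := by positivity
    have hgap : 7 * m0 / 32 ≤ κ₁ - κ₂ - C * t * m0 := by linarith
    have hρle : C * t * m0 ≤ κ₁ - κ₂ := by linarith
    have key := admixture_sq_le_of_quasimode β h₁ h₂ he₁ he₂ hn₁ hn₂ h₁₂ s hρle ha hq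
    rw [hs] at key
    -- `8Ct·(7λ₀/32)² ≤ 8Ct(κ₁−κ₂−ρ)² ≤ (Ctλ₀)²(1 + 8Ct) ≤ (Ctλ₀)²·(5/4)`: impossible for `0 < Ct ≤ 1/32`
    have h1 : (7 * m0 / 32) ^ 2 ≤ (κ₁ - κ₂ - C * t * m0) ^ 2 := pow_le_pow_left₀ (by positivity) hgap 2
    have h2 : 8 * (C * t) * (7 * m0 / 32) ^ 2 ≤ (C * t * m0) ^ 2 * (1 + 8 * (C * t)) :=
      (mul_le_mul_of_nonneg_left h1 (by positivity)).trans key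
    have h3 : (C * t * m0) ^ 2 * (1 + 8 * (C * t)) ≤ (C * t) * m0 ^ 2 * (5 / 128) := by
      have h4 : 1 + 8 * (C * t) ≤ 5 / 4 := by linarith
      have h5 : (C * t * m0) ^ 2 * (1 + 8 * (C * t)) ≤ (C * t * m0) ^ 2 * (5 / 4) :=
        mul_le_mul_of_nonneg_left h4 (sq_nonneg _)
      have h6 : (C * t * m0) ^ 2 * (5 / 4) = (C * t) * ((C * t) * m0 ^ 2 * (5 / 4)) := by ring
      have h7 : (C * t) * m0 ^ 2 * (5 / 4) ≤ (1 / 32) * m0 ^ 2 * (5 / 4) := by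
        have := mul_le_mul_of_nonneg_right hCt (show 0 ≤ m0 ^ 2 * (5 / 4) by positivity)
        nlinarith
      calc (C * t * m0) ^ 2 * (1 + 8 * (C * t)) ≤ (C * t * m0) ^ 2 * (5 / 4) := h5
        _ = (C * t) * ((C * t) * m0 ^ 2 * (5 / 4)) := h6
        _ ≤ (C * t) * ((1 / 32) * m0 ^ 2 * (5 / 4)) := mul_le_mul_of_nonneg_left h7 hCt0.le
        _ = (C * t) * m0 ^ 2 * (5 / 128) := by ring
    have h8 : 8 * (C * t) * (7 * m0 / 32) ^ 2 = (C * t) * m0 ^ 2 * (49 / 128) := by ring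
    have hpos : 0 < (C * t) * m0 ^ 2 := mul_pos hCt0 (pow_pos hm0 2)
    nlinarith [h2, h3, h8, hpos]

end TwoLevel

end Summit.QuantumFields.YangMills.Theorems.FemtoTransferGap.PolyakovLift.Negative

end
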